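import Mathlib.Algebra.Order.BigOperators.Ring.Finset
import Mathlib.Topology.Algebra.InfiniteSum.Real
import Summits.AnomalousDissipation.AnomalousDissipation.Theorems.SawtoothPulseCascadeK1LocalisedCascadeSpectralLeakage

/-!
# K1loc, line `Spectral` / SeqCone — helper: SPECTRAL LEAKAGE FOR SMOOTH SYMBOLS (the form the induction iterates)

Second helper file of the first prover lane on the crux `K1LocalisedCascade` (stmt-AnomalousDissipation-19491), route
`SawtoothPulseCascade`.  The companion file `…SpectralLeakage` records the leakage lemma for SHARP sets of modes; the
architecture note attached to the item (evidence `K1loc-architecture-findings-k1locp1.md`, F-a) explains why the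
per-half-pulse induction must instead track SMOOTH spectral symbols `m : ℤ^d → ℝ` (two slope families per half-pulse:
amplitudes, not energies, add across sharp sets).  This file proves the smooth-symbol leakage lemma on
`T^d = UnitAddTorus d`, again in the tree's vocabulary (`mFourierCoeff`, `ScalarFourier.lconv`, Parseval):

**Smooth-symbol leakage lemma.**  Let `F, Θ : T^d → ℂ` be continuous with absolutely summable Fourier coefficients,
`‖Θ x‖ ≤ 1`, let `m : ℤ^d → ℝ` be a bounded symbol and `ω : ℤ^d → ℝ≥0` a modulus for it,
`|m k − m (k − n)| ≤ ω n` for all `k, n`, with `∑ₙ ω n ‖𝓕Θ n‖ < ∞`.  Then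

  `√(∑ₖ (m k)² ‖𝓕(Θ F)(k)‖²) ≤ √(∑ₖ (m k)² ‖𝓕F(k)‖²) + (∑ₙ ω n ‖𝓕Θ n‖) · √(∫ ‖F‖²)`,

i.e. `‖m(D)(ΘF)‖ ≤ ‖m(D)F‖ + (∑ₙ ω(n)|𝓕Θ(n)|)·‖F‖`: multiplication by a unimodular-bounded multiplier commutes with a
smooth spectral cut-off up to (Lipschitz constant of the symbol) × (first moment of `𝓕Θ`).  For a symbol varying on
frequency scale `L` one takes `ω n = min (2 sup|m|) (|n|/L)`.

Proof (all in this file): with `c = 𝓕Θ`, `f = 𝓕F`, `𝓕(ΘF)(k) = ∑ₙ c n f (k−n)` (`ScalarFourier.mFourierCoeff_mul`), so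
`m k · 𝓕(ΘF)(k) = P k + R k`, `P k = ∑ₙ c n (m f)(k−n) = 𝓕(Θ · H)(k)` with `H` the synthesis of `m f`
(`‖Θ H‖_{L²} ≤ ‖H‖_{L²} = ‖m f‖_{ℓ²}`), and `R k = ∑ₙ c n (m k − m (k−n)) f (k−n)`,
`‖R k‖ ≤ ∑ₙ ‖c n‖ ω n ‖f (k−n)‖`; a weighted Cauchy–Schwarz in `n` and Tonelli in `(n,k)` give
`∑ₖ ‖R k‖² ≤ (∑ₙ ‖c n‖ ω n)² ∑ₖ ‖f k‖²`; Minkowski in `ℓ²` (companion file) concludes.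

WHAT THIS IS NOT: no statement about the cascade or the stub itself; a line-independent Fourier tool.
[cite: Grafakos2014, Prop. 3.1.2 (5) (coefficients of products) and Prop. 3.2.7 (3) (Parseval)] [problem: turb]
-/

-- `Summit.<Summit>.<Problem>`: single-conjunct summit, the duplicate namespace segment is deliberate.
set_option linter.dupNamespace false

noncomputable section

namespace Summit.AnomalousDissipation.AnomalousDissipation.Theorems.SawtoothPulseCascade.SpectralLeakage

open MeasureTheory Set Filter Topology UnitAddTorus Complex
open scoped ENNReal NNReal
open Literature.Analysis Literature.Analysis.FunctionSpaces Literature.Analysis.FluidPDE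
open Literature.Analysis.FunctionSpaces.Torus
open Literature.Analysis.FluidPDE.ScalarFourier (lconv lconv_apply)

variable {d : Type*} [Fintype d]

/-! ## §1 Two summation tools: weighted Cauchy–Schwarz and a shifted Tonelli identity -/

omit [Fintype d] in
/-- **Weighted Cauchy–Schwarz for series**: if `0 ≤ r, f, g`, `f, g` summable and `r i ^ 2 ≤ f i * g i` termwise, then
`r` is summable and `(∑ r)² ≤ (∑ f)(∑ g)` (finite Cauchy–Schwarz `Finset.sum_sq_le_sum_mul_sum_of_sq_le_mul` and
monotone limits). [folklore] -/
theorem tsum_sq_le_tsum_mul_tsum {ι : Type*} {r f g : ι → ℝ} (hr : ∀ i, 0 ≤ r i) (hf : ∀ i, 0 ≤ f i)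
    (hg : ∀ i, 0 ≤ g i) (hfs : Summable f) (hgs : Summable g) (h : ∀ i, r i ^ 2 ≤ f i * g i) :
    Summable r ∧ (∑' i, r i) ^ 2 ≤ (∑' i, f i) * ∑' i, g i := by
  classical
  -- `r ≤ (f + g)/2` termwise, so `r` is summable
  have hle : ∀ i, r i ≤ (f i + g i) / 2 := fun i => by
    nlinarith [h i, sq_nonneg (f i - g i), hr i, hf i, hg i, sq_nonneg (r i - (f i + g i) / 2)]
  have hrs : Summable r :=
    ((hfs.add hgs).div_const 2).of_nonneg_of_le hr fun i => by simpa [add_div] using hle i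
  refine ⟨hrs, ?_⟩
  -- finite Cauchy–Schwarz on every finset, then pass to the limit
  have hfin : ∀ s : Finset ι, (∑ i ∈ s, r i) ^ 2 ≤ (∑' i, f i) * ∑' i, g i := fun s =>
    calc (∑ i ∈ s, r i) ^ 2 ≤ (∑ i ∈ s, f i) * ∑ i ∈ s, g i :=
          Finset.sum_sq_le_sum_mul_sum_of_sq_le_mul s (fun i _ => hf i) (fun i _ => hg i) fun i _ => h i
      _ ≤ (∑' i, f i) * ∑' i, g i :=
          mul_le_mul (hfs.sum_le_tsum s fun i _ => hf i) (hgs.sum_le_tsum s fun i _ => hg i)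
            (Finset.sum_nonneg fun i _ => hg i) (tsum_nonneg hf)
  have hsqrt : ∀ s : Finset ι, ∑ i ∈ s, r i ≤ Real.sqrt ((∑' i, f i) * ∑' i, g i) := fun s =>
    Real.le_sqrt_of_sq_le (hfin s)
  have hle' : ∑' i, r i ≤ Real.sqrt ((∑' i, f i) * ∑' i, g i) := hrs.tsum_le_of_sum_le hsqrt
  calc (∑' i, r i) ^ 2 ≤ (Real.sqrt ((∑' i, f i) * ∑' i, g i)) ^ 2 :=
        pow_le_pow_left₀ (tsum_nonneg hr) hle' 2
    _ = (∑' i, f i) * ∑' i, g i := Real.sq_sqrt (mul_nonneg (tsum_nonneg hf) (tsum_nonneg hg))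

omit [Fintype d] in
/-- **Shifted Tonelli**: for nonnegative `a` (summable) and `φ` (summable),
`∑ₖ ∑ₙ a n φ (k − n) = (∑ₙ a n)(∑ₖ φ k)`, together with the summability of the inner and outer families. [folklore] -/
theorem tsum_tsum_mul_shift {a φ : (d → ℤ) → ℝ} (ha0 : ∀ n, 0 ≤ a n) (hφ0 : ∀ k, 0 ≤ φ k)
    (ha : Summable a) (hφ : Summable φ) :
    (∀ k, Summable fun n => a n * φ (k - n)) ∧ (Summable fun k => ∑' n, a n * φ (k - n)) ∧
      ∑' k, ∑' n, a n * φ (k - n) = (∑' n, a n) * ∑' k, φ k := by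
  -- the uncurried family `(n, k) ↦ a n φ (k - n)` is summable (Tonelli for nonnegative families)
  have hshift : ∀ n, ∑' k, φ (k - n) = ∑' k, φ k := fun n => (Equiv.subRight n).tsum_eq φ
  have hshift_s : ∀ n, Summable fun k => φ (k - n) := fun n => (Equiv.subRight n).summable_iff.mpr hφ
  have hrow : ∀ n, Summable fun k => a n * φ (k - n) := fun n => (hshift_s n).mul_left (a n)
  have hrow_sum : ∀ n, ∑' k, a n * φ (k - n) = a n * ∑' k, φ k := fun n => by
    rw [tsum_mul_left, hshift n]
  have hU : Summable (Function.uncurry fun n k => a n * φ (k - n)) := by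
    refine (summable_prod_of_nonneg fun p => mul_nonneg (ha0 p.1) (hφ0 _)).mpr ⟨hrow, ?_⟩
    simp_rw [hrow_sum]
    exact ha.mul_right _
  -- column summability and the swap
  have hcol : ∀ k, Summable fun n => a n * φ (k - n) := fun k => hU.prod_symm.prod_factor k
  have hswap : ∑' k, ∑' n, a n * φ (k - n) = ∑' n, ∑' k, a n * φ (k - n) := hU.tsum_comm
  refine ⟨hcol, ?_, ?_⟩
  · have := hU.prod_symm.prod
    simpa [Function.uncurry] using this
  · rw [hswap]
    simp_rw [hrow_sum]
    rw [tsum_mul_right]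

/-! ## §2 The smooth-symbol leakage lemma -/

omit [Fintype d] in
/-- An absolutely summable family is bounded by its `ℓ¹` norm. [folklore] -/
theorem norm_le_tsum_norm {c : (d → ℤ) → ℂ} (hc : Summable fun k => ‖c k‖) (k : d → ℤ) :
    ‖c k‖ ≤ ∑' j, ‖c j‖ :=
  hc.le_tsum k fun _ _ => norm_nonneg _

/-- **Smooth-symbol spectral leakage under multiplication** (`‖m(D)(ΘF)‖ ≤ ‖m(D)F‖ + (∑ₙ ω n ‖𝓕Θ n‖)·‖F‖`).
Let `F, Θ : T^d → ℂ` be continuous with absolutely summable Fourier coefficients and `‖Θ x‖ ≤ 1`; let `m` be a real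
symbol with `|m| ≤ M` and modulus `ω ≥ 0`, `|m k − m (k − n)| ≤ ω n`, such that `∑ₙ ω n ‖𝓕Θ n‖ < ∞`.  Then
`√(∑ₖ (m k)²‖𝓕(ΘF) k‖²) ≤ √(∑ₖ (m k)²‖𝓕F k‖²) + (∑ₙ ω n ‖𝓕Θ n‖)·√(∫‖F‖²)`.
[cite: Grafakos2014, Prop. 3.1.2 (5) (coefficients of products are lattice convolutions) and Prop. 3.2.7 (3) (Parseval)] -/
theorem sqrt_tsum_symbol_sq_mul_le {F Θ : UnitAddTorus d → ℂ} (hF : Continuous F)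
    (hFs : Summable fun k => ‖mFourierCoeff F k‖) (hΘ : Continuous Θ)
    (hΘs : Summable fun k => ‖mFourierCoeff Θ k‖) (hΘ1 : ∀ x, ‖Θ x‖ ≤ 1)
    {m : (d → ℤ) → ℝ} {M : ℝ} (hmM : ∀ k, |m k| ≤ M) {ω : (d → ℤ) → ℝ} (hω0 : ∀ n, 0 ≤ ω n)
    (hω : ∀ k n, |m k - m (k - n)| ≤ ω n) (hωs : Summable fun n => ω n * ‖mFourierCoeff Θ n‖) :
    Real.sqrt (∑' k, m k ^ 2 * ‖mFourierCoeff (fun x => Θ x * F x) k‖ ^ 2) ≤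
      Real.sqrt (∑' k, m k ^ 2 * ‖mFourierCoeff F k‖ ^ 2) +
        (∑' n, ω n * ‖mFourierCoeff Θ n‖) * Real.sqrt (∫ x, ‖F x‖ ^ 2) := by
  classical
  -- names
  set c : (d → ℤ) → ℂ := mFourierCoeff Θ with hc_def
  set f : (d → ℤ) → ℂ := mFourierCoeff F with hf_def
  have hM0 : 0 ≤ M := (abs_nonneg _).trans (hmM 0)
  have hB1 : ∀ j, ‖f j‖ ≤ ∑' i, ‖f i‖ := norm_le_tsum_norm hFs
  set B₁ : ℝ := ∑' i, ‖f i‖ with hB₁_def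
  -- the synthesis `H` of `m f`
  set h : (d → ℤ) → ℂ := fun k => (m k : ℂ) * f k with hh_def
  have hh : Summable fun k => ‖h k‖ :=
    (hFs.mul_left M).of_nonneg_of_le (fun _ => norm_nonneg _) fun k => by
      rw [hh_def, norm_mul, Complex.norm_real, Real.norm_eq_abs]
      exact mul_le_mul_of_nonneg_right (hmM k) (norm_nonneg _)
  set H : UnitAddTorus d → ℂ := fourierSynth h with hH_def
  have hH_c : Continuous H := continuous_fourierSynth hh
  have hH_coeff : ∀ k, mFourierCoeff H k = h k := mFourierCoeff_fourierSynth hh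
  -- the product coefficients as a lattice convolution
  have hprod : ∀ k, mFourierCoeff (fun x => Θ x * F x) k = ∑' n, c n * f (k - n) := fun k => by
    rw [ScalarFourier.mFourierCoeff_mul hΘ hΘs hF k, lconv_apply]
  -- summability of the pieces (bounded × summable)
  have hs1 : ∀ k, Summable fun n => c n * f (k - n) := fun k =>
    .of_norm <| (hΘs.mul_right B₁).of_nonneg_of_le (fun _ => norm_nonneg _) fun n => by
      rw [norm_mul]; exact mul_le_mul_of_nonneg_left (hB1 _) (norm_nonneg _)
  have hsP : ∀ k, Summable fun n => c n * ((m (k - n) : ℂ) * f (k - n)) := fun k =>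
    .of_norm <| (hΘs.mul_right (M * B₁)).of_nonneg_of_le (fun _ => norm_nonneg _) fun n => by
      rw [norm_mul, norm_mul, Complex.norm_real, Real.norm_eq_abs]
      exact mul_le_mul_of_nonneg_left (mul_le_mul (hmM _) (hB1 _) (norm_nonneg _) hM0) (norm_nonneg _)
  have hsR : ∀ k, Summable fun n => c n * (((m k - m (k - n) : ℝ) : ℂ) * f (k - n)) := fun k =>
    .of_norm <| ((hωs.mul_right B₁)).of_nonneg_of_le (fun _ => norm_nonneg _) fun n => by
      rw [norm_mul, norm_mul, Complex.norm_real, Real.norm_eq_abs]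
      calc ‖c n‖ * (|m k - m (k - n)| * ‖f (k - n)‖) ≤ ‖c n‖ * (ω n * B₁) :=
            mul_le_mul_of_nonneg_left (mul_le_mul (hω k n) (hB1 _) (norm_nonneg _) (hω0 n)) (norm_nonneg _)
        _ = ω n * ‖c n‖ * B₁ := by ring
  -- `P` and `R`
  set P : (d → ℤ) → ℂ := fun k => ∑' n, c n * ((m (k - n) : ℂ) * f (k - n)) with hP_def
  set R : (d → ℤ) → ℂ := fun k => ∑' n, c n * (((m k - m (k - n) : ℝ) : ℂ) * f (k - n)) with hR_def
  have hsplit : ∀ k, (m k : ℂ) * mFourierCoeff (fun x => Θ x * F x) k = P k + R k := fun k => by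
    rw [hprod k, ← tsum_mul_left, hP_def, hR_def]
    simp only
    rw [← (hsP k).tsum_add (hsR k)]
    refine tsum_congr fun n => ?_
    push_cast
    ring
  -- `P` is the coefficient family of `Θ H`
  have hP : ∀ k, P k = mFourierCoeff (fun x => Θ x * H x) k := fun k => by
    rw [ScalarFourier.mFourierCoeff_mul hΘ hΘs hH_c k, lconv_apply, hP_def]
    simp only
    refine tsum_congr fun n => ?_
    rw [hH_coeff]
  have hΘH_c : Continuous fun x => Θ x * H x := hΘ.mul hH_c
  have hParsP := hasSum_sq_mFourierCoeff_of_continuous hΘH_c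
  have hParsH : HasSum (fun k => ‖h k‖ ^ 2) (∫ x, ‖H x‖ ^ 2) := by
    have := hasSum_sq_mFourierCoeff_of_continuous hH_c
    simp_rw [hH_coeff] at this
    exact this
  have hParsF := hasSum_sq_mFourierCoeff_of_continuous hF
  have hP_le : ∑' k, ‖P k‖ ^ 2 ≤ ∑' k, m k ^ 2 * ‖f k‖ ^ 2 := by
    simp_rw [hP]
    rw [hParsP.tsum_eq]
    have h1 : ∫ x, ‖Θ x * H x‖ ^ 2 ≤ 1 ^ 2 * ∫ x, ‖H x‖ ^ 2 := integral_norm_sq_mul_le hH_c hΘ1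
    rw [one_pow, one_mul, ← hParsH.tsum_eq] at h1
    refine h1.trans_eq (tsum_congr fun k => ?_)
    rw [hh_def, norm_mul, Complex.norm_real, Real.norm_eq_abs, mul_pow, sq_abs]
  -- the leakage bound on `R`
  set A : ℝ := ∑' n, ω n * ‖c n‖ with hA_def
  have hA0 : 0 ≤ A := tsum_nonneg fun n => mul_nonneg (hω0 n) (norm_nonneg _)
  have hTon := tsum_tsum_mul_shift (a := fun n => ω n * ‖c n‖) (φ := fun k => ‖f k‖ ^ 2)
    (fun n => mul_nonneg (hω0 n) (norm_nonneg _)) (fun k => sq_nonneg _) hωs hParsF.summable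
  obtain ⟨hTon1, hTon2, hTon3⟩ := hTon
  have hR_pt : ∀ k, ‖R k‖ ^ 2 ≤ A * ∑' n, ω n * ‖c n‖ * ‖f (k - n)‖ ^ 2 := fun k => by
    -- `‖R k‖ ≤ ∑ₙ ‖c n‖ ω n ‖f (k-n)‖`, then weighted Cauchy–Schwarz
    have hr0 : ∀ n, 0 ≤ ω n * ‖c n‖ * ‖f (k - n)‖ := fun n =>
      mul_nonneg (mul_nonneg (hω0 n) (norm_nonneg _)) (norm_nonneg _)
    have hCS := tsum_sq_le_tsum_mul_tsum (r := fun n => ω n * ‖c n‖ * ‖f (k - n)‖)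
      (f := fun n => ω n * ‖c n‖) (g := fun n => ω n * ‖c n‖ * ‖f (k - n)‖ ^ 2) hr0
      (fun n => mul_nonneg (hω0 n) (norm_nonneg _)) (fun n => mul_nonneg (mul_nonneg (hω0 n) (norm_nonneg _))
        (sq_nonneg _)) hωs (hTon1 k) (fun n => le_of_eq (by ring))
    have hRle : ‖R k‖ ≤ ∑' n, ω n * ‖c n‖ * ‖f (k - n)‖ := by
      rw [hR_def]
      refine (norm_tsum_le_tsum_norm (hsR k).norm).trans ?_
      refine (hsR k).norm.tsum_le_tsum (fun n => ?_) hCS.1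
      rw [norm_mul, norm_mul, Complex.norm_real, Real.norm_eq_abs]
      calc ‖c n‖ * (|m k - m (k - n)| * ‖f (k - n)‖) ≤ ‖c n‖ * (ω n * ‖f (k - n)‖) :=
            mul_le_mul_of_nonneg_left (mul_le_mul_of_nonneg_right (hω k n) (norm_nonneg _)) (norm_nonneg _)
        _ = ω n * ‖c n‖ * ‖f (k - n)‖ := by ring
    calc ‖R k‖ ^ 2 ≤ (∑' n, ω n * ‖c n‖ * ‖f (k - n)‖) ^ 2 := pow_le_pow_left₀ (norm_nonneg _) hRle 2
      _ ≤ A * ∑' n, ω n * ‖c n‖ * ‖f (k - n)‖ ^ 2 := hCS.2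
  have hR_le : ∑' k, ‖R k‖ ^ 2 ≤ A ^ 2 * ∫ x, ‖F x‖ ^ 2 := by
    have hRs : Summable fun k => ‖R k‖ ^ 2 :=
      (hTon2.mul_left A).of_nonneg_of_le (fun _ => sq_nonneg _) hR_pt
    calc ∑' k, ‖R k‖ ^ 2 ≤ ∑' k, A * ∑' n, ω n * ‖c n‖ * ‖f (k - n)‖ ^ 2 :=
          hRs.tsum_le_tsum hR_pt (hTon2.mul_left A)
      _ = A * (A * ∑' k, ‖f k‖ ^ 2) := by rw [tsum_mul_left, hTon3]
      _ = A ^ 2 * ∫ x, ‖F x‖ ^ 2 := by rw [hParsF.tsum_eq]; ring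
  -- Minkowski
  have hPs : Summable fun k => ‖P k‖ ^ 2 := by
    simp_rw [hP]; exact hParsP.summable
  have hRs : Summable fun k => ‖R k‖ ^ 2 :=
    (hTon2.mul_left A).of_nonneg_of_le (fun _ => sq_nonneg _) hR_pt
  obtain ⟨hsumPR, hMink⟩ := sqrt_tsum_add_sq_le (fun k => norm_nonneg (P k)) (fun k => norm_nonneg (R k)) hPs hRs
  have hLHS : ∀ k, m k ^ 2 * ‖mFourierCoeff (fun x => Θ x * F x) k‖ ^ 2 ≤ (‖P k‖ + ‖R k‖) ^ 2 := fun k => by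
    have : m k ^ 2 * ‖mFourierCoeff (fun x => Θ x * F x) k‖ ^ 2 = ‖(m k : ℂ) * mFourierCoeff (fun x => Θ x * F x) k‖ ^ 2 := by
      rw [norm_mul, Complex.norm_real, Real.norm_eq_abs, mul_pow, sq_abs]
    rw [this, hsplit k]
    exact pow_le_pow_left₀ (norm_nonneg _) (norm_add_le _ _) 2
  have hLHSs : Summable fun k => m k ^ 2 * ‖mFourierCoeff (fun x => Θ x * F x) k‖ ^ 2 :=
    hsumPR.of_nonneg_of_le (fun k => by positivity) hLHS
  calc Real.sqrt (∑' k, m k ^ 2 * ‖mFourierCoeff (fun x => Θ x * F x) k‖ ^ 2)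
      ≤ Real.sqrt (∑' k, (‖P k‖ + ‖R k‖) ^ 2) := Real.sqrt_le_sqrt (hLHSs.tsum_le_tsum hLHS hsumPR)
    _ ≤ Real.sqrt (∑' k, ‖P k‖ ^ 2) + Real.sqrt (∑' k, ‖R k‖ ^ 2) := hMink
    _ ≤ Real.sqrt (∑' k, m k ^ 2 * ‖f k‖ ^ 2) + Real.sqrt (A ^ 2 * ∫ x, ‖F x‖ ^ 2) :=
        add_le_add (Real.sqrt_le_sqrt hP_le) (Real.sqrt_le_sqrt hR_le)
    _ = Real.sqrt (∑' k, m k ^ 2 * ‖f k‖ ^ 2) + A * Real.sqrt (∫ x, ‖F x‖ ^ 2) := by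
        rw [Real.sqrt_mul' _ (integral_nonneg fun x => by positivity), Real.sqrt_sq hA0]

end Summit.AnomalousDissipation.AnomalousDissipation.Theorems.SawtoothPulseCascade.SpectralLeakage
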